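import Summits.NavierStokesRegularity.NavierStokesRegularity.Cruxes.MinimalDatumPFold.Disproof
import Summits.NavierStokesRegularity.NavierStokesRegularity.Theorems.AxisymmetricExtremalityMinimalDatumPFoldOfSymmGap

/-!
# crux-ideate r2 / ideator k4 — idea `maximal-symmetry-transfer` (crux `MinimalDatumPFold`,
stmt-NavierStokesRegularity-15452)

The crux (⇔ AXB over the tree, Disproof §1) FACTORS as

* `SymmetricBlowupTransfer` (T, the (B)-piece): Clay failure at `ν` ⇒ for unboundedly many `p ≥ 2`
  SOME a.e.-`R_{2π/p}`-equivariant blow-up datum exists (no cost, no minimality);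
* `ThresholdUniversality` (W, the (S)-piece): Clay failure at `ν` ⇒ every `p`-fold class (p ≥ 2)
  that blows up at all blows up at cost `< ρ_max^pure(ν) + ε` for every `ε > 0`.

`minimalDatumPFold_of_transfer_universality : T → W → MinimalDatumPFold` is the landed attainment
theorem `minimalDatumPFold_of_symmGapClosing` (p152445) fed with T ∧ W; both pieces are CONSEQUENCES of
the crux (`transfer_of_minimalDatumPFold`, `universality_of_minimalDatumPFold`), so the cut is exact,
and neither piece alone is the crux (T: no cost; W: needs a p-fold bad datum to fire).
`ThresholdUniversalityStrong` is the antecedent-free universality law ("the critical blow-up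
threshold is blind to compact symmetry constraints that permit blow-up"); `NecklaceCostFloor` records
why far-field robustness (the only (B)-tool) can deliver T but never W.
-/

set_option linter.dupNamespace false
set_option linter.unusedVariables false

noncomputable section

open MeasureTheory Set Function Filter Topology
open scoped ENNReal NNReal

namespace Summit.NavierStokesRegularity.NavierStokesRegularity.Cruxes.MinimalDatumPFold.Ideator4

open Literature.Analysis.FluidPDE Literature.Analysis.FunctionSpaces
open Summit.NavierStokesRegularity.NavierStokesRegularity.Theses.AxisymmetricExtremality
open Summit.NavierStokesRegularity.NavierStokesRegularity.Cruxes.MinimalDatumPFold.Disproof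

local notation "ℝ³" => EuclideanSpace ℝ (Fin 3)
local notation "ℂ³" => EuclideanSpace ℂ (Fin 3)

/-- An admissible (L³, represented in `Ḣ^{1/2}`, weakly divergence-free) BLOW-UP datum at viscosity
`ν` (no global Kato solution) that is a.e. equivariant under `R_{2π/p}` about the `x₂`-axis. No
minimality and no cost clause. -/
def IsPFoldBadDatum (ν : ℝ) (p : ℕ) (u₀ : ℝ³ → ℝ³) (g : HomSobolev ℝ³ ℂ³ (1 / 2 : ℝ)) : Prop :=
  MemLp u₀ 3 (volume : Measure ℝ³) ∧ g.Represents (EuclideanSpace.complexify ∘ u₀) ∧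
    IsWeaklyDivFree u₀ ∧ ¬ HasGlobalKatoSolution ν u₀ ∧
    ∀ᵐ x ∂(volume : Measure ℝ³), u₀ (rot (2 * Real.pi / p) x) = rot (2 * Real.pi / p) (u₀ x)

/-- **T — symmetric blow-up TRANSFER** (the (B)-piece of the crux): if Clay (A) fails at `ν`, then for
unboundedly many `p ≥ 2` some `p`-fold symmetric admissible datum has no global Kato solution
(`ρ_p(ν) < ∞` for unboundedly many `p`). -/
def SymmetricBlowupTransfer : Prop :=
  ∀ ν : ℝ, 0 < ν → ClayFails ν → ∀ N : ℕ, ∃ p : ℕ, N ≤ p ∧ 2 ≤ p ∧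
    ∃ (u₀ : ℝ³ → ℝ³) (g : HomSobolev ℝ³ ℂ³ (1 / 2 : ℝ)), IsPFoldBadDatum ν p u₀ g

/-- **W — threshold UNIVERSALITY** (the (S)-piece of the crux, Clay-failure regime): a `p`-fold class
that blows up at all blows up at the unrestricted cost (`ρ_p(ν) < ∞ ⇒ ρ_p(ν) = ρ_max^pure(ν)`, infimum
form). -/
def ThresholdUniversality : Prop :=
  ∀ ν : ℝ, 0 < ν → ClayFails ν → ∀ p : ℕ, 2 ≤ p →
    (∃ (u₀ : ℝ³ → ℝ³) (g : HomSobolev ℝ³ ℂ³ (1 / 2 : ℝ)), IsPFoldBadDatum ν p u₀ g) →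
    ∀ ε : ℝ≥0∞, 0 < ε → ∃ (u₀ : ℝ³ → ℝ³) (g : HomSobolev ℝ³ ℂ³ (1 / 2 : ℝ)),
      IsPFoldBadDatum ν p u₀ g ∧ ‖g‖ₑ < rusinSverakRhoMaxPure ν + ε

/-- **W⁺ — the universality LAW proper** (antecedent-free, strictly stronger than W): at every
viscosity and for every `p ≥ 2`, if the `p`-fold class contains a blow-up datum then it contains
blow-up data of cost arbitrarily close to the unrestricted threshold. -/
def ThresholdUniversalityStrong : Prop :=
  ∀ ν : ℝ, 0 < ν → ∀ p : ℕ, 2 ≤ p →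
    (∃ (u₀ : ℝ³ → ℝ³) (g : HomSobolev ℝ³ ℂ³ (1 / 2 : ℝ)), IsPFoldBadDatum ν p u₀ g) →
    ∀ ε : ℝ≥0∞, 0 < ε → ∃ (u₀ : ℝ³ → ℝ³) (g : HomSobolev ℝ³ ℂ³ (1 / 2 : ℝ)),
      IsPFoldBadDatum ν p u₀ g ∧ ‖g‖ₑ < rusinSverakRhoMaxPure ν + ε

theorem thresholdUniversality_of_strong (h : ThresholdUniversalityStrong) : ThresholdUniversality :=
  fun ν hν _ p hp hex ε hε => h ν hν p hp hex ε hε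

/-- **GLUE (the line's composition): T ∧ W ⇒ crux**, through the LANDED attainment theorem
`minimalDatumPFold_of_symmGapClosing` (p152445: Rusin–Šverák weak-limit blow-up + modulation +
symmetry-defect + recentring + a.e.→exact). -/
theorem minimalDatumPFold_of_transfer_universality
    (hT : SymmetricBlowupTransfer) (hW : ThresholdUniversality) : MinimalDatumPFold := by
  apply Summit.NavierStokesRegularity.NavierStokesRegularity.Theorems.minimalDatumPFold_of_symmGapClosing
  intro ν hν hclay N
  obtain ⟨p, hNp, h2p, u₀, g, hbad⟩ := hT ν hν hclay N
  refine ⟨p, hNp, h2p, fun ε hε => ?_⟩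
  obtain ⟨u₁, g₁, ⟨h1, h2, h3, h4, h5⟩, hlt⟩ := hW ν hν hclay p h2p ⟨u₀, g, hbad⟩ ε hε
  exact ⟨u₁, g₁, h1, h2, h3, h4, hlt, h5⟩

/-- Exactness on the transfer side: **T is a consequence of the crux** (a minimal datum is a bad
datum; everywhere-equivariance is a.e.-equivariance). -/
theorem transfer_of_minimalDatumPFold (h : MinimalDatumPFold) : SymmetricBlowupTransfer := by
  intro ν hν hclay N
  obtain ⟨p, hNp, h2p, u₀, g, hmin, hsym⟩ := h ν hν hclay N
  obtain ⟨h1, h2, h3, -, h5⟩ := hmin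
  exact ⟨p, hNp, h2p, u₀, g, h1, h2, h3, h5, Filter.Eventually.of_forall fun x => hsym x⟩

/-- Exactness on the universality side: **W is a consequence of the crux** — via the axisymmetric
normal form (Disproof §1 `minimalDatumPFold_iff_axisymmetricForm`, which uses the PROVED sibling crux
`PFoldToAxisymmetric`): an axisymmetric minimal datum is, for every `p` and every `ε`, a cheap
a.e.-`p`-fold bad datum. So the cut T ∧ W ⇔ crux is exact, with neither piece the crux. -/
theorem universality_of_minimalDatumPFold (h : MinimalDatumPFold) : ThresholdUniversality := by
  intro ν hν hclay p hp _ ε hε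
  obtain ⟨u₀, g, hmin, hax⟩ := (minimalDatumPFold_iff_axisymmetricForm.1 h) ν hν hclay
  obtain ⟨h1, h2, h3, hnorm, h5⟩ := hmin
  have hfin : rusinSverakRhoMaxPure ν < ⊤ := by
    rw [← hnorm]
    exact enorm_lt_top
  refine ⟨u₀, g, ⟨h1, h2, h3, h5, Filter.Eventually.of_forall fun x => hax _ x⟩, ?_⟩
  rw [hnorm]
  exact ENNReal.lt_add_right hfin.ne hε.ne'

/-- **Necklace cost floor** (why the only (B)-tool, far-field robustness, delivers T and never W):
`p` vectors of equal norm `r` that are pairwise `δ`-orthogonal have `‖∑ v_k‖² ≥ p r² − p (p−1) δ`.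
Applied to the `p` rotated far translates `R^k τ_{L e₀} φ` of a blow-up datum `φ` (pairwise inner
products → 0 as `L → ∞`, Riemann–Lebesgue on `|ξ| |φ̂|² ∈ L¹`): necklaces cost `√p · ρ_max + o(1)`,
so robustness of blow-up under far-field superposition gives `ρ_p ≤ √p ρ_max < ∞` (= T) and nothing
about `ρ_p = ρ_max` (= W). -/
def NecklaceCostFloor : Prop :=
  ∀ {E : Type} [NormedAddCommGroup E] [InnerProductSpace ℝ E] (p : ℕ) (v : Fin p → E) (r δ : ℝ),
    (∀ k, ‖v k‖ = r) → (∀ k l, k ≠ l → |inner ℝ (v k) (v l)| ≤ δ) →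
      (p : ℝ) * r ^ 2 - p * (p - 1) * δ ≤ ‖∑ k, v k‖ ^ 2

/-- The two-vector instance of the floor, proved (the general case is the same double sum). -/
theorem necklace_two {E : Type} [NormedAddCommGroup E] [InnerProductSpace ℝ E] (v w : E) (r δ : ℝ)
    (hv : ‖v‖ = r) (hw : ‖w‖ = r) (hδ : |inner ℝ v w| ≤ δ) :
    2 * r ^ 2 - 2 * δ ≤ ‖v + w‖ ^ 2 := by
  have h := norm_add_sq_real v w
  rw [h, hv, hw]
  have : -δ ≤ inner ℝ v w := by
    have := neg_abs_le (inner ℝ v w)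
    linarith
  linarith

end Summit.NavierStokesRegularity.NavierStokesRegularity.Cruxes.MinimalDatumPFold.Ideator4

end
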